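import Literature.Analysis.FluidPDE.TaoCascadeDuhamel
import Mathlib.Analysis.Calculus.Deriv.MeanValue
import Mathlib.Analysis.Calculus.MeanValue
import HarnessLib

/-!
# Tao's cascade equation: restart identity and linear estimates for the scalar heat fibres

T. Tao, *Finite time blowup for an averaged three-dimensional Navier–Stokes equation*,
J. Amer. Math. Soc. **29** (2016), 601–674 = arXiv:1402.0290v3, §4, proof of Lemma 4.1 (4.14)–(4.15).

A complement to `TaoCascadeDuhamel.lean` (Parts VIII–X there): elementary facts about the scalar
Duhamel function `duhamelScalar δ Qr L t = e^{-Lt}(δ + ∫₀ᵗ Qr e^{Ls})` (the heat fibre of one mode driven by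
a **general continuous real forcing** `Qr`) and about its averages against the frequency weight
`modeWeight 𝒟 i n = |ψ̂_{i,n}|²` of a mode, as needed by the local (Picard) theory of the lifted Volterra
system of the cascade equation (3.3):

* `duhamelScalar_restart`: the semigroup / restart identity
  `φ_L(t) = e^{-L(t-T)} φ_L(T) + e^{-Lt} ∫_T^t Qr e^{Ls}`, and the resulting bound for `L ≥ 0`, `T ≤ t`,
  `|φ_L(t)| ≤ |φ_L(T)| + (t-T) sup_{[T,t]} |Qr|` (`abs_duhamelScalar_le_restart`);
* `duhamelScalar_congr` (only `Qr|_{[0,t]}` matters), `duhamelScalar_sub` (linearity in `(δ, Qr)`);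
* `abs_integral_mul_modeWeight_le`: `|∫ f |ψ̂_{i,n}|²| ≤ sup |f|` (the weight is a probability density);
* `hasDerivAt_integral_duhamelScalar_modeWeight` / `…_sq_modeWeight`: `X̃' = -A + Qr`, `Ẽ' = -B + 2 Qr X̃` for
  `X̃(t) = ∫ φ(ξ,t)|ψ̂|²`, `Ẽ(t) = ∫ φ(ξ,t)²|ψ̂|²` and a general continuous forcing (the tree's
  `hasDerivAt_modeScalarX/E` are the same statements for the forcing of a mild solution);
* `sq_integral_duhamelScalar_le`: `X̃² ≤ Ẽ` (Cauchy–Schwarz, (4.12)); `integral_duhamelScalar_sq_le`: the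
  integrated local energy inequality `Ẽ(t) ≤ δ² + 2∫₀ᵗ Qr X̃` for `t ≥ 0` ((4.11), dropping `B ≥ 0`);
* `abs_integral_duhamelScalar_le_restart`, `abs_integral_duhamelScalar_sub_le`: the two linear estimates of
  the Picard scheme — `|X̃(t)| ≤ |δ| + T sup_{[0,T]}|Qr| + (t-T) sup_{[T,t]}|Qr|`, and
  `|X̃[Qr](t) - X̃[Qr'](t)| ≤ (t-T) sup_{[T,t]}|Qr - Qr'|` when `Qr = Qr'` on `[0,T]`;
* `abs_integral_mul_heatRate_mul_modeWeight_le` (`|∫ f λ |ψ̂|²| ≤ Λ_n sup|f|`, `Λ_n = modeRateBound ε₀ n`) and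
  `lipschitzOnWith_integral_duhamelScalar_modeWeight`: `X̃` is Lipschitz on `[0,T]` with constant
  `Λ_n(|δ| + T sup_{[0,T]}|Qr|) + sup_{[0,T]}|Qr|` (mean value theorem with `X̃' = -A + Qr`);
* `continuous_quadTerm_clamp`, `quadTerm_congr`, `abs_quadTerm_le_of_abs_le`: the forcing
  `s ↦ quadTerm_{i,n}(X(max(s,0)))` of the lifted system is continuous for continuous coefficients, depends only
  on `X(·, s)`, and is `O_{α,n}(M²)` when every coefficient is bounded by `M`.

## References

* T. Tao, J. Amer. Math. Soc. 29 (2016), 601–674, arXiv:1402.0290v3, §4 Lemma 4.1 (4.11)–(4.15). Key `Tao2016AveragedNS`.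
-/

noncomputable section

open MeasureTheory Set Filter Metric
open scoped Topology

namespace Literature.Analysis.FluidPDE.Tao2016

/-! ## The scalar fibre: restart, congruence, linearity -/

section Scalar

variable {δ : ℝ} {Qr Qr' : ℝ → ℝ}

/-- The integrand `Qr(s) e^{Ls}` of the scalar Duhamel function is continuous. [folklore] -/
theorem continuous_mul_exp (hQ : Continuous Qr) (L : ℝ) : Continuous fun s => Qr s * Real.exp (L * s) :=
  hQ.mul (Real.continuous_exp.comp (continuous_const.mul continuous_id))

/-- **Restart (semigroup) identity** for the scalar Duhamel function:
`φ_L(t) = e^{-L(t-T)} φ_L(T) + e^{-Lt} ∫_T^t Qr(s) e^{Ls} ds`. [folklore] -/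
theorem duhamelScalar_restart (hQ : Continuous Qr) (L T t : ℝ) :
    duhamelScalar δ Qr L t = Real.exp (-(L * (t - T))) * duhamelScalar δ Qr L T +
      Real.exp (-(L * t)) * ∫ s in T..t, Qr s * Real.exp (L * s) := by
  have hg := continuous_mul_exp hQ L
  simp only [duhamelScalar]
  rw [← intervalIntegral.integral_add_adjacent_intervals (hg.intervalIntegrable 0 T) (hg.intervalIntegrable T t),
    show -(L * (t - T)) = -(L * t) + L * T by ring, Real.exp_add]
  have h1 : Real.exp (L * T) * Real.exp (-(L * T)) = 1 := by rw [← Real.exp_add, add_neg_cancel, Real.exp_zero]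
  linear_combination (-(Real.exp (-(L * t)) * (δ + ∫ s in (0 : ℝ)..T, Qr s * Real.exp (L * s)))) * h1

/-- **Restart bound**: for `L ≥ 0` and `T ≤ t`, `|φ_L(t)| ≤ |φ_L(T)| + (t - T) · sup_{[T,t]} |Qr|`
(`e^{-L(t-T)} ≤ 1` and `e^{-L(t-s)} ≤ 1` on `[T,t]`). [folklore] -/
theorem abs_duhamelScalar_le_restart (hQ : Continuous Qr) {L T t Cq : ℝ} (hL : 0 ≤ L) (hTt : T ≤ t)
    (hC : ∀ s ∈ Icc T t, |Qr s| ≤ Cq) :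
    |duhamelScalar δ Qr L t| ≤ |duhamelScalar δ Qr L T| + (t - T) * Cq := by
  have hCq : 0 ≤ Cq := (abs_nonneg _).trans (hC T ⟨le_rfl, hTt⟩)
  have hint : |∫ s in T..t, Qr s * Real.exp (L * s)| ≤ Cq * Real.exp (L * t) * (t - T) := by
    have h := intervalIntegral.norm_integral_le_of_norm_le_const (a := T) (b := t) (C := Cq * Real.exp (L * t))
      (f := fun s => Qr s * Real.exp (L * s)) fun s hs => by
        rw [uIoc_of_le hTt] at hs
        rw [norm_mul, Real.norm_eq_abs, Real.norm_eq_abs, abs_of_pos (Real.exp_pos _)]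
        exact mul_le_mul (hC s ⟨hs.1.le, hs.2⟩) (Real.exp_le_exp.2 (mul_le_mul_of_nonneg_left hs.2 hL))
          (Real.exp_pos _).le hCq
    rwa [Real.norm_eq_abs, abs_of_nonneg (sub_nonneg.2 hTt)] at h
  rw [duhamelScalar_restart hQ L T t]
  refine (abs_add_le _ _).trans (add_le_add ?_ ?_)
  · rw [abs_mul, Real.abs_exp]
    exact mul_le_of_le_one_left (abs_nonneg _)
      (Real.exp_le_one_iff.2 (neg_nonpos.2 (mul_nonneg hL (sub_nonneg.2 hTt))))
  · rw [abs_mul, Real.abs_exp]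
    calc Real.exp (-(L * t)) * |∫ s in T..t, Qr s * Real.exp (L * s)|
        ≤ Real.exp (-(L * t)) * (Cq * Real.exp (L * t) * (t - T)) := mul_le_mul_of_nonneg_left hint (Real.exp_pos _).le
      _ = (t - T) * Cq * (Real.exp (-(L * t)) * Real.exp (L * t)) := by ring
      _ = (t - T) * Cq := by rw [← Real.exp_add, neg_add_cancel, Real.exp_zero, mul_one]

/-- Only the forcing on `[0,t]` matters for `φ_L(t)`, `t ≥ 0`. [folklore] -/
theorem duhamelScalar_congr {L t : ℝ} (ht : 0 ≤ t) (h : ∀ s ∈ Icc 0 t, Qr s = Qr' s) :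
    duhamelScalar δ Qr L t = duhamelScalar δ Qr' L t := by
  simp only [duhamelScalar]
  rw [intervalIntegral.integral_congr fun s hs => ?_]
  rw [uIcc_of_le ht] at hs
  show Qr s * Real.exp (L * s) = Qr' s * Real.exp (L * s)
  rw [h s hs]

/-- **Linearity**: fibres with the same datum differ by the fibre of the difference of the forcings
with zero datum. [folklore] -/
theorem duhamelScalar_sub (hQ : Continuous Qr) (hQ' : Continuous Qr') (L t : ℝ) :
    duhamelScalar δ Qr L t - duhamelScalar δ Qr' L t = duhamelScalar 0 (fun s => Qr s - Qr' s) L t := by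
  simp only [duhamelScalar, sub_mul, zero_add]
  rw [intervalIntegral.integral_sub ((continuous_mul_exp hQ L).intervalIntegrable _ _)
    ((continuous_mul_exp hQ' L).intervalIntegrable _ _)]
  ring

/-- The fibre with zero datum and zero forcing vanishes. [folklore] -/
theorem duhamelScalar_zero_zero (L t : ℝ) : duhamelScalar 0 (fun _ => 0) L t = 0 := by
  simp [duhamelScalar]

end Scalar

/-! ## Averages against the frequency weight of a mode -/

section Lifted

variable {ε₀ : ℝ} {m : ℕ} {𝒟 : CascadeWaveletData ε₀ m} {i : Fin m} {n : ℤ} {δ : ℝ} {Qr Qr' : ℝ → ℝ}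

/-- **`|∫ f |ψ̂_{i,n}|²| ≤ sup |f|`**: the weight is a probability density (no integrability of `f` is
needed: a non-integrable integrand has integral `0 ≤ sup|f|`). [folklore] -/
theorem abs_integral_mul_modeWeight_le (hε : 0 < 1 + ε₀) {f : EuclideanSpace ℝ (Fin 3) → ℝ} {M : ℝ}
    (hf : ∀ ξ, |f ξ| ≤ M) : |∫ ξ, f ξ * modeWeight 𝒟 i n ξ| ≤ M := by
  rw [← Real.norm_eq_abs]
  refine (norm_integral_le_of_norm_le ((integrable_modeWeight (𝒟 := 𝒟) (i := i) (n := n)).const_mul M)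
    (Eventually.of_forall fun ξ => ?_)).trans (le_of_eq ?_)
  · rw [Real.norm_eq_abs, abs_mul, abs_of_nonneg (modeWeight_nonneg ξ)]
    exact mul_le_mul_of_nonneg_right (hf ξ) (modeWeight_nonneg ξ)
  · rw [integral_const_mul, integral_modeWeight hε, mul_one]

/-- The averaged fibre `ξ ↦ φ_{λ(ξ)}(t) |ψ̂_{i,n}(ξ)|²` is integrable. [folklore] -/
theorem integrable_duhamelScalar_mul_modeWeight (hε : 0 < 1 + ε₀) (hQ : Continuous Qr) (t : ℝ) :
    Integrable (fun ξ : EuclideanSpace ℝ (Fin 3) => duhamelScalar δ Qr (heatRate ξ) t * modeWeight 𝒟 i n ξ) := by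
  simpa only [pow_one] using integrable_duhamelScalar_pow_mul (δ := δ) hQ integrable_modeWeight
    (modeWeight_eq_zero (𝒟 := 𝒟) (i := i) (n := n) hε) 1 t

/-- **`X̃' = -A + Qr`** for a general continuous forcing: the average `X̃(t) = ∫ φ_{λ(ξ)}(t)|ψ̂_{i,n}|²`
is differentiable on `ℝ` with derivative `-∫ λ φ |ψ̂|² + Qr(t)` (differentiation under the integral,
`∫ |ψ̂|² = 1`). [cite: Tao2016AveragedNS, Lemma 4.1 (4.15)] -/
theorem hasDerivAt_integral_duhamelScalar_modeWeight (hε : 0 < 1 + ε₀) (hQ : Continuous Qr) (t : ℝ) :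
    HasDerivAt (fun t => ∫ ξ, duhamelScalar δ Qr (heatRate ξ) t * modeWeight 𝒟 i n ξ)
      (-(∫ ξ, duhamelScalar δ Qr (heatRate ξ) t * (heatRate ξ * modeWeight 𝒟 i n ξ)) + Qr t) t := by
  have h := (hasDerivAt_integral_duhamelScalar_pow (δ := δ) hQ integrable_modeWeight
    (modeWeight_eq_zero (𝒟 := 𝒟) (i := i) (n := n) hε) 1 t).2
  have hA : Integrable fun ξ => duhamelScalar δ Qr (heatRate ξ) t * (heatRate ξ * modeWeight 𝒟 i n ξ) := by
    simpa only [pow_one] using integrable_duhamelScalar_pow_mul (δ := δ) hQ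
      (integrable_heatRate_mul_modeWeight (𝒟 := 𝒟) (i := i) (n := n) hε) (heatRate_mul_modeWeight_eq_zero hε) 1 t
  have hform : (fun t => ∫ ξ, duhamelScalar δ Qr (heatRate ξ) t ^ 1 * modeWeight 𝒟 i n ξ) =
      fun t => ∫ ξ, duhamelScalar δ Qr (heatRate ξ) t * modeWeight 𝒟 i n ξ := by
    simp only [pow_one]
  rw [hform] at h
  refine h.congr_deriv ?_
  have hsplit : ∀ ξ : EuclideanSpace ℝ (Fin 3), ((1 : ℕ) : ℝ) * duhamelScalar δ Qr (heatRate ξ) t ^ (1 - 1) *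
      (-(heatRate ξ) * duhamelScalar δ Qr (heatRate ξ) t + Qr t) * modeWeight 𝒟 i n ξ =
      Qr t * modeWeight 𝒟 i n ξ - duhamelScalar δ Qr (heatRate ξ) t * (heatRate ξ * modeWeight 𝒟 i n ξ) := by
    intro ξ; ring
  simp_rw [hsplit]
  rw [integral_sub (integrable_modeWeight.const_mul _) hA, integral_const_mul, integral_modeWeight hε, mul_one]
  ring

/-- The average `X̃(t) = ∫ φ_{λ(ξ)}(t)|ψ̂_{i,n}|²` is continuous on `ℝ`. [folklore] -/
theorem continuous_integral_duhamelScalar_modeWeight (hε : 0 < 1 + ε₀) (hQ : Continuous Qr) :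
    Continuous fun t => ∫ ξ, duhamelScalar δ Qr (heatRate ξ) t * modeWeight 𝒟 i n ξ :=
  continuous_iff_continuousAt.2 fun t => (hasDerivAt_integral_duhamelScalar_modeWeight hε hQ t).continuousAt

/-- **`Ẽ' = -B + 2 Qr X̃`** for a general continuous forcing, `Ẽ(t) = ∫ φ_{λ(ξ)}(t)² |ψ̂_{i,n}|²`,
`B = 2∫ λ φ² |ψ̂|² ≥ 0`. [cite: Tao2016AveragedNS, Lemma 4.1 (4.11)] -/
theorem hasDerivAt_integral_duhamelScalar_sq_modeWeight (hε : 0 < 1 + ε₀) (hQ : Continuous Qr) (t : ℝ) :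
    HasDerivAt (fun t => ∫ ξ, duhamelScalar δ Qr (heatRate ξ) t ^ 2 * modeWeight 𝒟 i n ξ)
      (-(2 * ∫ ξ, duhamelScalar δ Qr (heatRate ξ) t ^ 2 * (heatRate ξ * modeWeight 𝒟 i n ξ)) +
        2 * (Qr t * ∫ ξ, duhamelScalar δ Qr (heatRate ξ) t * modeWeight 𝒟 i n ξ)) t := by
  have h := (hasDerivAt_integral_duhamelScalar_pow (δ := δ) hQ integrable_modeWeight
    (modeWeight_eq_zero (𝒟 := 𝒟) (i := i) (n := n) hε) 2 t).2
  have hB := integrable_duhamelScalar_pow_mul (δ := δ) hQ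
    (integrable_heatRate_mul_modeWeight (𝒟 := 𝒟) (i := i) (n := n) hε) (heatRate_mul_modeWeight_eq_zero hε) 2 t
  have hX := integrable_duhamelScalar_mul_modeWeight (𝒟 := 𝒟) (i := i) (n := n) (δ := δ) hε hQ t
  refine h.congr_deriv ?_
  have hsplit : ∀ ξ : EuclideanSpace ℝ (Fin 3), ((2 : ℕ) : ℝ) * duhamelScalar δ Qr (heatRate ξ) t ^ (2 - 1) *
      (-(heatRate ξ) * duhamelScalar δ Qr (heatRate ξ) t + Qr t) * modeWeight 𝒟 i n ξ =
      (2 : ℝ) * (Qr t * (duhamelScalar δ Qr (heatRate ξ) t * modeWeight 𝒟 i n ξ)) -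
        (2 : ℝ) * (duhamelScalar δ Qr (heatRate ξ) t ^ 2 * (heatRate ξ * modeWeight 𝒟 i n ξ)) := by
    intro ξ; ring
  simp_rw [hsplit]
  rw [integral_sub ((hX.const_mul _).const_mul _) (hB.const_mul _), integral_const_mul, integral_const_mul,
    integral_const_mul]
  ring

/-- **Cauchy–Schwarz against the probability density, (4.12)**: `X̃(t)² ≤ Ẽ(t)`, i.e.
`(∫ φ |ψ̂|²)² ≤ ∫ φ² |ψ̂|²` (expand `0 ≤ ∫ (φ - X̃)² |ψ̂|²`). [cite: Tao2016AveragedNS, Lemma 4.1 (4.12)] -/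
theorem sq_integral_duhamelScalar_le (hε : 0 < 1 + ε₀) (hQ : Continuous Qr) (t : ℝ) :
    (∫ ξ, duhamelScalar δ Qr (heatRate ξ) t * modeWeight 𝒟 i n ξ) ^ 2 ≤
      ∫ ξ, duhamelScalar δ Qr (heatRate ξ) t ^ 2 * modeWeight 𝒟 i n ξ := by
  set c := ∫ ξ, duhamelScalar δ Qr (heatRate ξ) t * modeWeight 𝒟 i n ξ with hc
  have hX := integrable_duhamelScalar_mul_modeWeight (𝒟 := 𝒟) (i := i) (n := n) (δ := δ) hε hQ t
  have h2 := integrable_duhamelScalar_pow_mul (δ := δ) hQ integrable_modeWeight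
    (modeWeight_eq_zero (𝒟 := 𝒟) (i := i) (n := n) hε) 2 t
  have h0 : 0 ≤ ∫ ξ, (duhamelScalar δ Qr (heatRate ξ) t - c) ^ 2 * modeWeight 𝒟 i n ξ :=
    integral_nonneg fun ξ => mul_nonneg (sq_nonneg _) (modeWeight_nonneg ξ)
  have hexp : ∀ ξ, (duhamelScalar δ Qr (heatRate ξ) t - c) ^ 2 * modeWeight 𝒟 i n ξ =
      duhamelScalar δ Qr (heatRate ξ) t ^ 2 * modeWeight 𝒟 i n ξ -
        2 * c * (duhamelScalar δ Qr (heatRate ξ) t * modeWeight 𝒟 i n ξ) + c ^ 2 * modeWeight 𝒟 i n ξ :=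
    fun ξ => by ring
  have h3 : Integrable fun ξ => duhamelScalar δ Qr (heatRate ξ) t ^ 2 * modeWeight 𝒟 i n ξ -
      2 * c * (duhamelScalar δ Qr (heatRate ξ) t * modeWeight 𝒟 i n ξ) := h2.sub (hX.const_mul _)
  simp_rw [hexp] at h0
  rw [integral_add h3 (integrable_modeWeight.const_mul _), integral_sub h2 (hX.const_mul _),
    integral_const_mul, integral_const_mul, integral_modeWeight hε, ← hc] at h0
  nlinarith [h0]

/-- **The integrated local energy inequality, (4.11)**: for `t ≥ 0`,
`Ẽ(t) ≤ δ² + 2 ∫₀ᵗ Qr(s) X̃(s) ds` (`Ẽ(0) = δ²`, and `Ẽ - 2∫₀ Qr X̃` has derivative `-B ≤ 0`). [cite: Tao2016AveragedNS, Lemma 4.1 (4.11)] -/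
theorem integral_duhamelScalar_sq_le (hε : 0 < 1 + ε₀) (hQ : Continuous Qr) {t : ℝ} (ht : 0 ≤ t) :
    ∫ ξ, duhamelScalar δ Qr (heatRate ξ) t ^ 2 * modeWeight 𝒟 i n ξ ≤
      δ ^ 2 + 2 * ∫ s in (0 : ℝ)..t, Qr s * ∫ ξ, duhamelScalar δ Qr (heatRate ξ) s * modeWeight 𝒟 i n ξ := by
  have hg : Continuous fun r => Qr r * ∫ ξ, duhamelScalar δ Qr (heatRate ξ) r * modeWeight 𝒟 i n ξ :=
    hQ.mul (continuous_integral_duhamelScalar_modeWeight (𝒟 := 𝒟) (i := i) (n := n) (δ := δ) hε hQ)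
  have hI : ∀ s, HasDerivAt (fun t => ∫ r in (0 : ℝ)..t, Qr r * ∫ ξ, duhamelScalar δ Qr (heatRate ξ) r * modeWeight 𝒟 i n ξ)
      (Qr s * ∫ ξ, duhamelScalar δ Qr (heatRate ξ) s * modeWeight 𝒟 i n ξ) s := fun s =>
    intervalIntegral.integral_hasDerivAt_right (hg.intervalIntegrable _ _) (hg.stronglyMeasurableAtFilter _ _)
      hg.continuousAt
  -- `Ẽ - 2∫₀ Qr X̃` has derivative `-B ≤ 0`, hence is antitone
  have hGd := fun s => (hasDerivAt_integral_duhamelScalar_sq_modeWeight (𝒟 := 𝒟) (i := i) (n := n) (δ := δ) hε hQ s).sub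
    ((hI s).const_mul 2)
  have hanti := antitone_of_deriv_nonpos (fun s => (hGd s).differentiableAt) fun s => by
    rw [(hGd s).deriv]
    have hB : 0 ≤ ∫ ξ, duhamelScalar δ Qr (heatRate ξ) s ^ 2 * (heatRate ξ * modeWeight 𝒟 i n ξ) :=
      integral_nonneg fun ξ => mul_nonneg (sq_nonneg _) (mul_nonneg (heatRate_nonneg ξ) (modeWeight_nonneg ξ))
    linarith
  have h := hanti ht
  simp only [Pi.sub_apply, intervalIntegral.integral_same, mul_zero, sub_zero, duhamelScalar_zero, integral_const_mul,
    integral_modeWeight hε, mul_one] at h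
  linarith

/-- **`|∫ f λ |ψ̂_{i,n}|²| ≤ Λ_n sup |f|`**: on the support of the weight the heat rate `λ = 4π²|ξ|²` is at most
`Λ_n = modeRateBound ε₀ n`. [folklore] -/
theorem abs_integral_mul_heatRate_mul_modeWeight_le (hε : 0 < 1 + ε₀) {f : EuclideanSpace ℝ (Fin 3) → ℝ} {M : ℝ}
    (hf : ∀ ξ, |f ξ| ≤ M) : |∫ ξ, f ξ * (heatRate ξ * modeWeight 𝒟 i n ξ)| ≤ modeRateBound ε₀ n * M := by
  rw [← Real.norm_eq_abs]
  refine (norm_integral_le_of_norm_le ((integrable_modeWeight (𝒟 := 𝒟) (i := i) (n := n)).const_mul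
    (modeRateBound ε₀ n * M)) ?_).trans (le_of_eq ?_)
  · filter_upwards [modeWeight_eq_zero (𝒟 := 𝒟) (i := i) (n := n) hε] with ξ hξ
    rw [Real.norm_eq_abs, abs_mul, abs_mul, abs_of_nonneg (heatRate_nonneg ξ), abs_of_nonneg (modeWeight_nonneg ξ)]
    by_cases hR : ‖ξ‖ ≤ modeRadius ε₀ n
    · have hL : heatRate ξ ≤ modeRateBound ε₀ n := heatRate_le (mem_closedBall_zero_iff.2 hR)
      calc |f ξ| * (heatRate ξ * modeWeight 𝒟 i n ξ) = heatRate ξ * |f ξ| * modeWeight 𝒟 i n ξ := by ring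
        _ ≤ modeRateBound ε₀ n * M * modeWeight 𝒟 i n ξ := mul_le_mul_of_nonneg_right
            (mul_le_mul hL (hf ξ) (abs_nonneg _) (modeRateBound_nonneg ε₀ n)) (modeWeight_nonneg ξ)
    · rw [hξ (not_le.1 hR), mul_zero, mul_zero, mul_zero]
  · rw [integral_const_mul, integral_modeWeight hε, mul_one]

/-- **`X̃` is Lipschitz on `[0,T]`** with constant `Λ_n(|δ| + T·sup_{[0,T]}|Qr|) + sup_{[0,T]}|Qr|`
(`X̃' = -∫λφ|ψ̂|² + Qr`, `|φ(ξ,t)| ≤ |δ| + t sup|Qr|`, mean value theorem). [folklore] -/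
theorem lipschitzOnWith_integral_duhamelScalar_modeWeight (hε : 0 < 1 + ε₀) (hQ : Continuous Qr) {T C : ℝ}
    (hC : ∀ s ∈ Icc 0 T, |Qr s| ≤ C) :
    LipschitzOnWith (Real.toNNReal (modeRateBound ε₀ n * (|δ| + T * C) + C))
      (fun t => ∫ ξ, duhamelScalar δ Qr (heatRate ξ) t * modeWeight 𝒟 i n ξ) (Icc 0 T) := by
  refine (convex_Icc 0 T).lipschitzOnWith_of_nnnorm_hasDerivWithin_le
    (fun t _ => (hasDerivAt_integral_duhamelScalar_modeWeight hε hQ t).hasDerivWithinAt) fun t ht => ?_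
  rw [← norm_toNNReal, Real.norm_eq_abs]
  refine Real.toNNReal_mono ?_
  have hC0 : 0 ≤ C := (abs_nonneg _).trans (hC 0 ⟨le_rfl, ht.1.trans ht.2⟩)
  have hφ : ∀ ξ, |duhamelScalar δ Qr (heatRate ξ) t| ≤ |δ| + T * C := fun ξ => by
    have h := abs_duhamelScalar_le_restart (δ := δ) hQ (heatRate_nonneg ξ) ht.1 fun s hs => hC s ⟨hs.1, hs.2.trans ht.2⟩
    rw [duhamelScalar_zero, sub_zero] at h
    nlinarith [ht.2, h]
  calc |-(∫ ξ, duhamelScalar δ Qr (heatRate ξ) t * (heatRate ξ * modeWeight 𝒟 i n ξ)) + Qr t|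
      ≤ |∫ ξ, duhamelScalar δ Qr (heatRate ξ) t * (heatRate ξ * modeWeight 𝒟 i n ξ)| + |Qr t| :=
        (abs_add_le _ _).trans (by rw [abs_neg])
    _ ≤ modeRateBound ε₀ n * (|δ| + T * C) + C :=
        add_le_add (abs_integral_mul_heatRate_mul_modeWeight_le hε hφ) (hC t ht)

/-- **Restart estimate for the average**: for `0 ≤ T ≤ t`,
`|X̃(t)| ≤ |δ| + T · sup_{[0,T]} |Qr| + (t - T) · sup_{[T,t]} |Qr|`. [folklore] -/
theorem abs_integral_duhamelScalar_le_restart (hε : 0 < 1 + ε₀) (hQ : Continuous Qr) {T t C₁ C₂ : ℝ} (hT : 0 ≤ T)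
    (hTt : T ≤ t) (h1 : ∀ s ∈ Icc 0 T, |Qr s| ≤ C₁) (h2 : ∀ s ∈ Icc T t, |Qr s| ≤ C₂) :
    |∫ ξ, duhamelScalar δ Qr (heatRate ξ) t * modeWeight 𝒟 i n ξ| ≤ |δ| + T * C₁ + (t - T) * C₂ := by
  refine abs_integral_mul_modeWeight_le hε fun ξ => ?_
  have hT' := abs_duhamelScalar_le_restart (δ := δ) hQ (heatRate_nonneg ξ) hT h1
  rw [duhamelScalar_zero, sub_zero] at hT'
  have ht' := abs_duhamelScalar_le_restart (δ := δ) hQ (heatRate_nonneg ξ) hTt h2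
  linarith

/-- **Lipschitz estimate for the average**: if two continuous forcings agree on `[0,T]` and differ by at
most `C` on `[T,t]` (`0 ≤ T ≤ t`), the averages of their fibres (same datum) differ by at most `(t-T)·C`. [folklore] -/
theorem abs_integral_duhamelScalar_sub_le (hε : 0 < 1 + ε₀) (hQ : Continuous Qr) (hQ' : Continuous Qr')
    {T t C : ℝ} (hT : 0 ≤ T) (hTt : T ≤ t) (h0 : ∀ s ∈ Icc 0 T, Qr s = Qr' s)
    (hC : ∀ s ∈ Icc T t, |Qr s - Qr' s| ≤ C) :
    |(∫ ξ, duhamelScalar δ Qr (heatRate ξ) t * modeWeight 𝒟 i n ξ) -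
        ∫ ξ, duhamelScalar δ Qr' (heatRate ξ) t * modeWeight 𝒟 i n ξ| ≤ (t - T) * C := by
  rw [← integral_sub (integrable_duhamelScalar_mul_modeWeight hε hQ t) (integrable_duhamelScalar_mul_modeWeight hε hQ' t)]
  simp_rw [← sub_mul]
  refine abs_integral_mul_modeWeight_le hε fun ξ => ?_
  rw [duhamelScalar_sub hQ hQ']
  have h := abs_duhamelScalar_le_restart (δ := 0) (Qr := fun s => Qr s - Qr' s) (hQ.sub hQ') (heatRate_nonneg ξ) hTt hC
  rwa [duhamelScalar_congr (Qr' := fun _ => 0) hT (fun s hs => sub_eq_zero.2 (h0 s hs)), duhamelScalar_zero_zero,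
    abs_zero, zero_add] at h

end Lifted

/-! ## The forcing of the lifted system -/

section Forcing

variable {ε₀ : ℝ} {m : ℕ} (α : Fin m → Fin m → Fin m → ℤ × ℤ × ℤ → ℝ)

/-- The forcing `s ↦ quadTerm_{i,n}(X(max(s,0)))` of the lifted Volterra system is continuous when every
coefficient `X_{j,k}` is. [folklore] -/
theorem continuous_quadTerm_clamp {X : Fin m → ℤ → ℝ → ℝ} (hX : ∀ j k, Continuous (X j k)) (i : Fin m) (n : ℤ) :
    Continuous fun s => TaoCascade.quadTerm ε₀ α X i n (max s 0) := by
  have hmax : Continuous fun s : ℝ => max s 0 := continuous_id.max continuous_const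
  simp only [TaoCascade.quadTerm]
  refine continuous_finsetSum _ fun i₁ _ => continuous_finsetSum _ fun i₂ _ => continuous_finsetSum _ fun μ _ => ?_
  exact continuous_const.mul (((hX _ _).comp hmax).mul ((hX _ _).comp hmax))

/-- `quadTerm_{i,n}(X(s))` depends only on the coefficients at time `s`. [folklore] -/
theorem quadTerm_congr {X Y : Fin m → ℤ → ℝ → ℝ} {s : ℝ} (h : ∀ j k, X j k s = Y j k s) (i : Fin m) (n : ℤ) :
    TaoCascade.quadTerm ε₀ α X i n s = TaoCascade.quadTerm ε₀ α Y i n s := by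
  simp only [TaoCascade.quadTerm, h]

/-- **Crude size bound**: if `|X_{j,k}(s)| ≤ M` for all modes then
`|quadTerm_{i,n}(X(s))| ≤ (∑_{i₁,i₂,μ} |α_{i₁i₂iμ}|) (1+ε₀)^{5n/2} M²` (for `ε₀ ≥ 0`: the shifts only lower the
exponent `5(n-μ₃)/2 ≤ 5n/2`). [cite: Tao2016AveragedNS, §4 (4.8)] -/
theorem abs_quadTerm_le_of_abs_le (hε : 0 ≤ ε₀) {X : Fin m → ℤ → ℝ → ℝ} {M s : ℝ}
    (hX : ∀ (j : Fin m) (k : ℤ), |X j k s| ≤ M) (i : Fin m) (n : ℤ) :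
    |TaoCascade.quadTerm ε₀ α X i n s| ≤
      (∑ i₁ : Fin m, ∑ i₂ : Fin m, ∑ μ ∈ TaoCascade.shiftSet, |α i₁ i₂ i μ|) * ((1 + ε₀) ^ ((5 : ℝ) * n / 2) * M ^ 2) := by
  have ha1 : 1 ≤ 1 + ε₀ := by linarith
  have hM : 0 ≤ M := (abs_nonneg _).trans (hX i n)
  have hterm : ∀ (i₁ i₂ : Fin m), ∀ μ ∈ TaoCascade.shiftSet,
      |α i₁ i₂ i μ * (1 + ε₀) ^ ((5 : ℝ) * ((n : ℝ) - (μ.2.2 : ℝ)) / 2) *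
          (X i₁ (n - μ.2.2 + μ.1) s * X i₂ (n - μ.2.2 + μ.2.1) s)| ≤
        |α i₁ i₂ i μ| * ((1 + ε₀) ^ ((5 : ℝ) * n / 2) * M ^ 2) := by
    intro i₁ i₂ μ hμ
    have hμ₃ : (0 : ℝ) ≤ μ.2.2 := by
      rcases (TaoCascade.mem_shiftSet_iff μ).1 hμ with rfl | rfl | rfl | rfl <;> simp
    rw [abs_mul, abs_mul, abs_mul, abs_of_pos (Real.rpow_pos_of_pos (by linarith) _), mul_assoc]
    refine mul_le_mul_of_nonneg_left (mul_le_mul (Real.rpow_le_rpow_of_exponent_le ha1 (by nlinarith)) ?_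
      (by positivity) (by positivity)) (abs_nonneg _)
    rw [sq]
    exact mul_le_mul (hX _ _) (hX _ _) (abs_nonneg _) hM
  unfold TaoCascade.quadTerm
  calc |∑ i₁ : Fin m, ∑ i₂ : Fin m, ∑ μ ∈ TaoCascade.shiftSet,
          α i₁ i₂ i μ * (1 + ε₀) ^ ((5 : ℝ) * ((n : ℝ) - (μ.2.2 : ℝ)) / 2) *
            (X i₁ (n - μ.2.2 + μ.1) s * X i₂ (n - μ.2.2 + μ.2.1) s)|
      ≤ ∑ i₁ : Fin m, ∑ i₂ : Fin m, ∑ μ ∈ TaoCascade.shiftSet,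
          |α i₁ i₂ i μ * (1 + ε₀) ^ ((5 : ℝ) * ((n : ℝ) - (μ.2.2 : ℝ)) / 2) *
            (X i₁ (n - μ.2.2 + μ.1) s * X i₂ (n - μ.2.2 + μ.2.1) s)| := by
        refine (Finset.abs_sum_le_sum_abs _ _).trans (Finset.sum_le_sum fun i₁ _ => ?_)
        refine (Finset.abs_sum_le_sum_abs _ _).trans (Finset.sum_le_sum fun i₂ _ => ?_)
        exact Finset.abs_sum_le_sum_abs _ _
    _ ≤ ∑ i₁ : Fin m, ∑ i₂ : Fin m, ∑ μ ∈ TaoCascade.shiftSet, |α i₁ i₂ i μ| * ((1 + ε₀) ^ ((5 : ℝ) * n / 2) * M ^ 2) :=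
        Finset.sum_le_sum fun i₁ _ => Finset.sum_le_sum fun i₂ _ => Finset.sum_le_sum fun μ hμ => hterm i₁ i₂ μ hμ
    _ = (∑ i₁ : Fin m, ∑ i₂ : Fin m, ∑ μ ∈ TaoCascade.shiftSet, |α i₁ i₂ i μ|) *
          ((1 + ε₀) ^ ((5 : ℝ) * n / 2) * M ^ 2) := by simp only [Finset.sum_mul]

end Forcing

end Literature.Analysis.FluidPDE.Tao2016

end
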